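import Literature.Computability.AlgebraicComplexity.DeterminantalComplexity
import Literature.Computability.AlgebraicComplexity.PencilFamily
import Literature.Computability.AlgebraicComplexity.StandardFamilies

/-!
# Girth obstruction to Białynicki-Birula admissibility (crux `UlrichPadded.OrbitCorankTwo`)

Support file for the crux `UlrichPadded.OrbitCorankTwo` (stmt-ValiantsHypothesis-15032).  Both
round-1 lines degenerate an affine representation `A = A₀ + L(x)` of `per_n` along a torus
`ρ_α(s) · A(s x) · ρ_β(s)` with integer row/column weights `α, β`; the limit `s → 0` exists iff the
weights are *admissible* — `constantCoeff (A i j) ≠ 0 → 0 ≤ α i + β j`,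
`homogeneousComponent 1 (A i j) ≠ 0 → -1 ≤ α i + β j`, `∑ α + ∑ β = -n` — and the limit is then a
levelled representation of the same size (`orbitCorankTwo_bbLimit_isAffineDetRepr`), hence non-tight
(`orbitCorankTwo_levelledCorankTwo`).  This file records the exact dual obstruction (the easy half of
the Farkas / Birkhoff–von Neumann "girth criterion" of card bb-anchor-no-jump, E1): admissible weights
exist in a given constant gauge only if EVERY permutation supported inside the support of `A` passes
through at least `n` constant-free entries.  In von zur Gathen's normal form `A₀ = 0 ⊕ 1_{m-1}` this
forbids, e.g., `ℓ_{0i} ≠ 0 ∧ ℓ_{i0} ≠ 0` for any `i ≥ 1` (the transposition `(0 i)` has girth `2 < n`),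
so DESTABILISATION ("every representation admits admissible weights") fails in every fixed gauge with
a short cycle in the support; gauge-freely it is decided by King's blow-up coefficients (lead c1 notes).
-/

noncomputable section

namespace Summit.ValiantsHypothesis.Theorems

open MvPolynomial Matrix
open Literature.Computability.AlgebraicComplexity
open scoped Classical

/-- **Girth obstruction (general form).**  If integer weights `α, β` with `∑ α + ∑ β = -n` satisfy
`0 ≤ α i + β j` wherever the constant term of `A i j` is non-zero and `-1 ≤ α i + β j` wherever its
linear part is non-zero, then along every permutation `σ` whose entries `A i (σ i)` all have a non-zero
constant term or a non-zero linear part, at least `n` of the entries have vanishing constant term.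
(Sum the weight inequalities along `σ`: `-n = ∑ i, (α i + β (σ i)) ≥ -#{i : constantCoeff = 0}`.) [folklore] -/
theorem orbitCorankTwo_admissible_girth {n m : ℕ} {R : Type*} [CommSemiring R]
    (A : Matrix (Fin m) (Fin m) (MvPolynomial (Fin n × Fin n) R)) (α β : Fin m → ℤ)
    (h0 : ∀ i j, constantCoeff (A i j) ≠ 0 → 0 ≤ α i + β j)
    (h1 : ∀ i j, homogeneousComponent 1 (A i j) ≠ 0 → -1 ≤ α i + β j)
    (hsum : ∑ i, α i + ∑ j, β j = -(n : ℤ)) (σ : Equiv.Perm (Fin m))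
    (hσ : ∀ i, constantCoeff (A i (σ i)) ≠ 0 ∨ homogeneousComponent 1 (A i (σ i)) ≠ 0) :
    n ≤ (Finset.univ.filter fun i => constantCoeff (A i (σ i)) = 0).card := by
  classical
  -- the weights summed along `σ`
  have hw : ∑ i, (α i + β (σ i)) = -(n : ℤ) := by
    rw [Finset.sum_add_distrib, Equiv.sum_comp σ β]
    exact hsum
  -- pointwise lower bound by the indicator of "constant-free"
  have hpt : ∀ i, (if constantCoeff (A i (σ i)) = 0 then (-1 : ℤ) else 0) ≤ α i + β (σ i) := by
    intro i
    split_ifs with hc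
    · rcases hσ i with h | h
      · exact absurd hc h
      · exact h1 i (σ i) h
    · exact h0 i (σ i) hc
  have hle : ∑ i, (if constantCoeff (A i (σ i)) = 0 then (-1 : ℤ) else 0) ≤ -(n : ℤ) := by
    rw [← hw]
    exact Finset.sum_le_sum fun i _ => hpt i
  rw [Finset.sum_ite, Finset.sum_const_zero, add_zero, Finset.sum_const, smul_neg, nsmul_one] at hle
  have : ((Finset.univ.filter fun i => constantCoeff (A i (σ i)) = 0).card : ℤ) ≥ n := by linarith
  exact_mod_cast this

/-- **Girth obstruction for affine representations.**  For a matrix `A` of affine linear forms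
(entries of total degree `≤ 1`, e.g. an `IsAffineDetRepr`) admitting admissible Białynicki-Birula
weights `α, β` (`∑ α + ∑ β = -n`), every permutation `σ` inside the support of `A`
(`A i (σ i) ≠ 0` for all `i`) uses at least `n` constant-free entries:
`n ≤ #{i : constantCoeff (A i (σ i)) = 0}`.  Contrapositive ("girth `< n` ⇒ not admissible in this
gauge"): the torus-degeneration lines need SPARSE supports. [folklore] -/
theorem orbitCorankTwo_admissible_girth_of_affine : ∀ {n m : ℕ} (A : Matrix (Fin m) (Fin m) (MvPolynomial (Fin n × Fin n) ℂ)), (∀ i j, (A i j).totalDegree ≤ 1) → ∀ (α β : Fin m → ℤ), (∀ i j, MvPolynomial.constantCoeff (A i j) ≠ 0 → 0 ≤ α i + β j) → (∀ i j, MvPolynomial.homogeneousComponent 1 (A i j) ≠ 0 → -1 ≤ α i + β j) → (∑ i, α i + ∑ j, β j = -(n : ℤ)) → ∀ (σ : Equiv.Perm (Fin m)), (∀ i, A i (σ i) ≠ 0) → n ≤ Nat.card {i : Fin m // MvPolynomial.constantCoeff (A i (σ i)) = 0} := by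
  intro n m A hdeg α β h0 h1 hsum σ hσ
  rw [Nat.card_eq_fintype_card, Fintype.card_subtype]
  refine orbitCorankTwo_admissible_girth A α β h0 h1 hsum σ fun i => ?_
  by_contra hcon
  push Not at hcon
  obtain ⟨hc, hl⟩ := hcon
  apply hσ i
  have hc' : coeff 0 (A i (σ i)) = 0 := hc
  rw [eq_homogeneousComponent_zero_add_one (hdeg i (σ i)), homogeneousComponent_zero, hc', hl,
    C_0, zero_add]

/-- **No admissible weights across a 2-cycle (`n ≥ 3`).**  If an affine matrix `A` has indices
`a, b` with `A a b ≠ 0`, `A b a ≠ 0` and non-zero CONSTANT diagonal entries `A i i` off `{a, b}`,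
then `A` admits no admissible weights for any `n ≥ 3`: the transposition `(a b)` (the identity if
`a = b`) lies in the support and has at most `2 < n` constant-free entries.  (In von zur Gathen's normal form `A₀ = 0 ⊕ 1` this is
the case `ℓ_{0b} · ℓ_{b0} ≠ 0`.) [folklore] -/
theorem orbitCorankTwo_not_admissible_of_two_cycle {n m : ℕ} (hn : 3 ≤ n)
    (A : Matrix (Fin m) (Fin m) (MvPolynomial (Fin n × Fin n) ℂ))
    (hdeg : ∀ i j, (A i j).totalDegree ≤ 1) {a b : Fin m}
    (hAab : A a b ≠ 0) (hAba : A b a ≠ 0)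
    (hdiag : ∀ i, i ≠ a → i ≠ b → constantCoeff (A i i) ≠ 0) (α β : Fin m → ℤ)
    (h0 : ∀ i j, constantCoeff (A i j) ≠ 0 → 0 ≤ α i + β j)
    (h1 : ∀ i j, homogeneousComponent 1 (A i j) ≠ 0 → -1 ≤ α i + β j) :
    ∑ i, α i + ∑ j, β j ≠ -(n : ℤ) := by
  classical
  intro hsum
  have hσ : ∀ i, A i (Equiv.swap a b i) ≠ 0 := by
    intro i
    by_cases hia : i = a
    · subst hia; rwa [Equiv.swap_apply_left]
    by_cases hib : i = b
    · subst hib; rwa [Equiv.swap_apply_right]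
    rw [Equiv.swap_apply_of_ne_of_ne hia hib]
    intro h
    exact hdiag i hia hib (by rw [h, map_zero])
  have hge := orbitCorankTwo_admissible_girth_of_affine A hdeg α β h0 h1 hsum (Equiv.swap a b) hσ
  rw [Nat.card_eq_fintype_card, Fintype.card_subtype] at hge
  have hsub : (Finset.univ.filter fun i => constantCoeff (A i (Equiv.swap a b i)) = 0) ⊆ {a, b} := by
    intro i hi
    rw [Finset.mem_filter] at hi
    rw [Finset.mem_insert, Finset.mem_singleton]
    by_contra h
    push Not at h
    rw [Equiv.swap_apply_of_ne_of_ne h.1 h.2] at hi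
    exact hdiag i h.1 h.2 hi.2
  have hcard := (Finset.card_le_card hsub).trans Finset.card_le_two
  omega

end Summit.ValiantsHypothesis.Theorems

end
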